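import Summits.Langlands.Langlands.Theorems.SoloInformedLanglandsGLOneTate
import Literature.NumberTheory.PAdicHodge.FontaineDpstUnconditional
import HarnessLib

/-!
# The Tate family is de Rham for the PINNED datum — unconditionally; the summit's content on
# `π_{‖·‖^k}` is local–global compatibility alone (rung Λ18)

Programme `solo-Langlands-informed` (statement analysis of `Summit.Langlands`).  Rung Λ17
(`SoloInformedLanglandsGLOneTate`) isolated an absolute necessary condition of the typed summit on a
tree-constructed object: `Langlands → (fontainePstAdicCompletion v ℓ hv).IsDeRhamFramed (𝟙 ⊗ tateChar (K_v) ℓ k)`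
for every `K`, `ℓ`, `v ∣ ℓ`, `k` (programme note T-dR(k)).  This file DISCHARGES that condition for every `k`
and every rank, with no hypothesis: since the D1 upgrade of the pin the period ring of
`fontainePstAdicCompletion v ℓ hv` IS the constructed `B_dR(K_v)` (`fontainePst_𝔅_eq_bdRPeriodRingData`), and
the Literature file `FontaineDpstUnconditional` proved that `𝟙_n ⊗ ε` is de Rham for it whenever
`ε(σ) = χ_ℓ(σ)^k` (`fontainePstAdicCompletion_isDeRhamFramed_one_tateTwist`, period `t^{-k}`; Fontaine 1994,
Exp. III Prop. 1.5.2).  The tree's `D2Cris.tateChar (K_v) ℓ k` has exactly these values (`D2Cris.coe_tateChar`).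

* §1 ★★ `isDeRhamFramed_twist_one_tateChar`: **T-dR(k) holds for every `k : ℕ` and every rank `n`** —
  `(fontainePstAdicCompletion v ℓ hv).IsDeRhamFramed (𝟙_n ⊗ tateChar (K_v) ℓ k)`, unconditionally.  Hence the
  conclusion of Λ17 `isDeRhamFramed_tateChar_of_langlands` carries no information about `Langlands`: the T-dR
  test of the statement is PASSED (census c545 of the programme, which had recorded T-dR(k ≥ 2) as open in the
  tree, is superseded).
* §2 ★★ `isGeometricFramed_twist_one_tateChar`: for EVERY reciprocity datum `𝓡`, every `ℓ` and every `k`,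
  `χ_ℓ^k = 𝟙 ⊗ tateChar K ℓ k : Γ_K →ₜ* GL_1(ℚ̄_ℓ)` is geometric in the summit's sense (`IsGeometricFramed 𝓡`):
  unramified at every `v ∤ ℓ` (Λ16 `eventually_isUnramifiedAt_twist_one_tateChar`) and de Rham at every `v ∣ ℓ`
  for the pinned `𝓡.pst ℓ v hv` (§1, transported along Λ13 `toLocal_twist_tateChar`, Λ12 `toLocal_one`).
* §3 ★★★ `exists_corresponds_normPow_iff_localGlobalCompatibleAt`: consequently, on the Tate family the
  (A)-existence statement of the summit is EXACTLY local–global compatibility at every finite place: for every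
  `𝓡`, `ι`, `k`, `(∃ ρ, IsGeometricFramed 𝓡 ρ ∧ Corresponds 𝓡 ι π_{‖·‖^k} ρ) ↔
  ∀ v, LocalGlobalCompatibleAt 𝓡 ι π_{‖·‖^k} χ_ℓ^k v` (Λ16 `exists_corresponds_normPow_iff` pins the partner,
  Λ16 `eventually_satakeFrobCompatibleAt_normPow_iff` gives the Satake clause, §2 the geometricity);
  ★★★ `automorphicToGalois_clause_normPow_iff_localGlobalCompatibleAt`: the same for the full (A)-clause
  (irreducible, geometric, corresponding, unique up to conjugacy); and
  `localGlobalCompatibleAt_normPow_of_automorphicToGalois`: (A) for `GL_1` and ANY `𝓡` yields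
  `LocalGlobalCompatibleAt 𝓡 ι π_{‖·‖^k} χ_ℓ^k v` at every finite `v`, and nothing else on this family is asked.
  What the tree can decide of these clauses is the programme's standing census: at `v ∤ ℓ` they concern the
  pinned `rec_v` on unramified characters; at `v ∣ ℓ` with `k ≥ 1` they read the Weil–Deligne half
  `IsWeilDeligneOf` of the `ε`-pinned datum on a RAMIFIED character, which Fontaine's clauses do not determine
  (`SoloInformedPinExclusion`).

No new definitions; no hypotheses beyond the data.

References: Fontaine, Astérisque 223 (1994), Exp. III §1.5, Prop. 1.5.2 (`D_dR(ℚ_ℓ(k)) = F · t^{-k}`);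
Fontaine–Mazur (1995), §1; Buzzard–Gee, LMS LNS 414 (2014), Conj. 3.2.1, 3.2.2; Serre (1968), Ch. I §1.2;
Taylor, *Galois representations* (2004), Conj. 7.
-/

noncomputable section

open scoped MatrixGroups Matrix Classical Polynomial NumberField
open NumberField IsDedekindDomain Field Polynomial Filter
open Literature.NumberTheory.Automorphic Literature.NumberTheory.GaloisRepresentations
open Literature.NumberTheory.PAdicHodge

namespace Summit.Langlands.Langlands.Theorems

namespace GLOneRigidity

variable {K : Type} [Field K] [NumberField K]

/-! ### §1 T-dR(k): the Tate family is de Rham for the pinned datum, unconditionally -/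

/-- ★★ **T-dR(k) for every `k` and every rank — unconditionally.**  For every number field `K`, prime `ℓ`, place
`v ∣ ℓ` and `n k : ℕ`, Fontaine's pinned datum at `K_v` declares `𝟙_n ⊗ tateChar (K_v) ℓ k : Γ_{K_v} →ₜ* GL_n(ℚ̄_ℓ)`
de Rham: its period ring is the constructed `B_dR(K_v)` and `t^{-k}` is a period
(`fontainePstAdicCompletion_isDeRhamFramed_one_tateTwist`, with `tateChar (K_v) ℓ k (σ) = χ_ℓ(σ)^k` from `ℚ_ℓ`,
`D2Cris.coe_tateChar`).  This is the conclusion of Λ17 `isDeRhamFramed_tateChar_of_langlands` WITHOUT its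
hypothesis `Langlands`.
[cite: FontaineAsterisque223III, Exp. III §1.5 and Prop. 1.5.2] [cite: FontaineMazurGeometric1995, §1] -/
theorem isDeRhamFramed_twist_one_tateChar (v : HeightOneSpectrum (𝓞 K)) (ℓ : ℕ) [Fact ℓ.Prime]
    (hv : ((ℓ : ℕ) : 𝓞 K) ∈ v.asIdeal) (n k : ℕ) :
    (fontainePstAdicCompletion v ℓ hv).IsDeRhamFramed
      (FramedRep.twist (1 : FramedGaloisRep (v.adicCompletion K) (PadicAlgCl ℓ) n)
        (D2Cris.tateChar (v.adicCompletion K) ℓ k)) :=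
  fontainePstAdicCompletion_isDeRhamFramed_one_tateTwist v hv (k : ℤ) _ fun σ => by
    rw [D2Cris.coe_tateChar, map_pow, zpow_natCast]
    rfl

/-! ### §2 `χ_ℓ^k` is geometric for every reciprocity datum -/

/-- ★★ **`χ_ℓ^k` is geometric in the summit's sense, for EVERY reciprocity datum `𝓡`** — unramified at all but
finitely many places (Λ16 `eventually_isUnramifiedAt_twist_one_tateChar`: at every `v ∤ ℓ`) and de Rham at every
`v ∣ ℓ` for the pinned `𝓡.pst ℓ v hv = fontainePstAdicCompletion v ℓ hv` (§1 along
`(𝟙 ⊗ tateChar K ℓ k)|Γ_{K_v} = 𝟙 ⊗ tateChar (K_v) ℓ k`, Λ13 `toLocal_twist_tateChar`, Λ12 `toLocal_one`).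
[cite: FontaineMazurGeometric1995, §1] [cite: SerreAbelianLadic1968, Ch. I §1.2 (Example: the cyclotomic character)] -/
theorem isGeometricFramed_twist_one_tateChar (𝓡 : ReciprocityData K) (ℓ : ℕ) [Fact ℓ.Prime] (k : ℕ) :
    IsGeometricFramed 𝓡 (FramedRep.twist (1 : FramedGaloisRep K (PadicAlgCl ℓ) 1) (D2Cris.tateChar K ℓ k)) := by
  refine ⟨eventually_isUnramifiedAt_twist_one_tateChar k, fun v hv => ?_⟩
  rw [D2Cris.toLocal_twist_tateChar, D2Cris.toLocal_one]
  exact isDeRhamFramed_twist_one_tateChar v ℓ hv 1 k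

/-! ### §3 On the Tate family the summit's (A) is local–global compatibility, and nothing else -/

section NormPow

variable {hcpt : isCompact_glFiniteIntegralLevel 1 K} {ℓ : ℕ} [Fact ℓ.Prime]

/-- ★★ **`Corresponds 𝓡 ι π_{‖·‖^k} χ_ℓ^k` is local–global compatibility at every finite place**: its Satake
conjunct holds outright (Λ16 `eventually_satakeFrobCompatibleAt_normPow_iff`, direction `←` at `ρ' = χ_ℓ^k`).
[cite: BuzzardGeeLMS2014, Conj. 3.2.1 and Rem. 3.2.5] [cite: TaylorGaloisRepresentations2004, Conj. 7] -/
theorem corresponds_normPow_iff_localGlobalCompatibleAt (𝓡 : ReciprocityData K) (ι : PadicAlgCl ℓ ≃+* ℂ) (k : ℕ)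
    {π : AutomorphicRepData (AutomorphyDatum.gl 1 K hcpt)}
    (hW : π.W = Submodule.span ℂ
      {fun g : (AdelicGroupData.gl 1 K).Adelic => (detTwist 1 (HeckeCharacter.normCharacter K ^ k) g : ℂ)})
    (hW' : π.W' = ⊥) :
    Corresponds 𝓡 ι π (FramedRep.twist (1 : FramedGaloisRep K (PadicAlgCl ℓ) 1) (D2Cris.tateChar K ℓ k)) ↔
      ∀ v : HeightOneSpectrum (𝓞 K),
        LocalGlobalCompatibleAt 𝓡 ι π (FramedRep.twist (1 : FramedGaloisRep K (PadicAlgCl ℓ) 1) (D2Cris.tateChar K ℓ k)) v :=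
  ⟨fun h => h.2, fun h => ⟨(eventually_satakeFrobCompatibleAt_normPow_iff ι k hW hW' _).2 rfl, h⟩⟩

/-- ★★★ **The (A)-existence statement at `π_{‖·‖^k}` is exactly local–global compatibility of `(π_{‖·‖^k}, χ_ℓ^k)`
at every finite place.**  For every `𝓡`, `ι`, `k`:
`(∃ ρ, IsGeometricFramed 𝓡 ρ ∧ Corresponds 𝓡 ι π_{‖·‖^k} ρ) ↔ ∀ v, LocalGlobalCompatibleAt 𝓡 ι π_{‖·‖^k} χ_ℓ^k v`
— Λ16 `exists_corresponds_normPow_iff` (the partner is `χ_ℓ^k`), §2 (it is geometric, for free) and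
`corresponds_normPow_iff_localGlobalCompatibleAt` (its Satake clause is free).  The geometricity and unramified
clauses of the typed summit thus carry NO content on the Tate family; all of it sits in the clauses reading the
pinned `𝓡.llc v` (every `v`) and, at `v ∣ ℓ`, the Weil–Deligne half of the pinned `𝓡.pst ℓ v hv` on the ramified
character `χ_ℓ^k|Γ_{K_v}` (`k ≥ 1`).
[cite: BuzzardGeeLMS2014, Conj. 3.2.1 and Conj. 3.2.2] [cite: TaylorGaloisRepresentations2004, Conj. 7]
[cite: FontaineMazurGeometric1995, §1] -/
theorem exists_corresponds_normPow_iff_localGlobalCompatibleAt (𝓡 : ReciprocityData K) (ι : PadicAlgCl ℓ ≃+* ℂ)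
    (k : ℕ) {π : AutomorphicRepData (AutomorphyDatum.gl 1 K hcpt)}
    (hW : π.W = Submodule.span ℂ
      {fun g : (AdelicGroupData.gl 1 K).Adelic => (detTwist 1 (HeckeCharacter.normCharacter K ^ k) g : ℂ)})
    (hW' : π.W' = ⊥) :
    (∃ ρ : FramedGaloisRep K (PadicAlgCl ℓ) 1, IsGeometricFramed 𝓡 ρ ∧ Corresponds 𝓡 ι π ρ) ↔
      ∀ v : HeightOneSpectrum (𝓞 K),
        LocalGlobalCompatibleAt 𝓡 ι π (FramedRep.twist (1 : FramedGaloisRep K (PadicAlgCl ℓ) 1) (D2Cris.tateChar K ℓ k)) v := by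
  rw [exists_corresponds_normPow_iff 𝓡 ι k hW hW', corresponds_normPow_iff_localGlobalCompatibleAt 𝓡 ι k hW hW']
  exact ⟨fun h => h.2, fun h => ⟨isGeometricFramed_twist_one_tateChar 𝓡 ℓ k, h⟩⟩

/-- ★★★ **The full (A)-clause of the summit at `π_{‖·‖^k}`, unfolded**: for every `𝓡`, `ι`, `k`, the statement
"`∃ ρ` irreducible, geometric, corresponding to `π_{‖·‖^k}`, unique up to conjugacy among corresponding `ρ'`" that
`AutomorphicToGalois 1 𝓡 hcpt` asserts at the L-algebraic cuspidal `π_{‖·‖^k}` (Λ17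
`exists_cuspidal_normPow_isLAlgebraic`) is equivalent to `∀ v, LocalGlobalCompatibleAt 𝓡 ι π_{‖·‖^k} χ_ℓ^k v`
(irreducibility: rank one, `isIrreducible_of_finrank_eq_one'`; uniqueness: Λ16 `isConjugate_of_corresponds_glOne`).
[cite: BuzzardGeeLMS2014, Conj. 3.2.1 and Conj. 3.2.2] [cite: TaylorGaloisRepresentations2004, Conj. 7] -/
theorem automorphicToGalois_clause_normPow_iff_localGlobalCompatibleAt (𝓡 : ReciprocityData K)
    (ι : PadicAlgCl ℓ ≃+* ℂ) (k : ℕ) {π : AutomorphicRepData (AutomorphyDatum.gl 1 K hcpt)}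
    (hW : π.W = Submodule.span ℂ
      {fun g : (AdelicGroupData.gl 1 K).Adelic => (detTwist 1 (HeckeCharacter.normCharacter K ^ k) g : ℂ)})
    (hW' : π.W' = ⊥) :
    (∃ ρ : FramedGaloisRep K (PadicAlgCl ℓ) 1,
        ρ.toGaloisRep.IsIrreducible ∧ IsGeometricFramed 𝓡 ρ ∧ Corresponds 𝓡 ι π ρ ∧
          ∀ ρ' : FramedGaloisRep K (PadicAlgCl ℓ) 1, Corresponds 𝓡 ι π ρ' → IsConjugate ρ ρ') ↔
      ∀ v : HeightOneSpectrum (𝓞 K),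
        LocalGlobalCompatibleAt 𝓡 ι π (FramedRep.twist (1 : FramedGaloisRep K (PadicAlgCl ℓ) 1) (D2Cris.tateChar K ℓ k)) v := by
  rw [← exists_corresponds_normPow_iff_localGlobalCompatibleAt 𝓡 ι k hW hW']
  refine ⟨fun ⟨ρ, _, hg, hc, _⟩ => ⟨ρ, hg, hc⟩, fun ⟨ρ, hg, hc⟩ => ?_⟩
  exact ⟨ρ, isIrreducible_of_finrank_eq_one' _ (Module.finrank_fin_fun _), hg, hc,
    fun ρ' hρ' => isConjugate_of_corresponds_glOne 𝓡 ι π hc hρ'⟩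

/-- ★★ **(A) for `GL_1` (any `𝓡`) delivers, on the Tate family, precisely local–global compatibility at every
place** — the `𝓡`-reading residue of Λ17 `automorphicToGalois_one_normPow` once geometricity is free (§2).
[cite: BuzzardGeeLMS2014, Conj. 3.2.1 and Conj. 3.2.2] [cite: TaylorGaloisRepresentations2004, Conj. 7] -/
theorem localGlobalCompatibleAt_normPow_of_automorphicToGalois (𝓡 : ReciprocityData K)
    (hA : AutomorphicToGalois 1 𝓡 hcpt) (ι : PadicAlgCl ℓ ≃+* ℂ) (k : ℕ) :
    ∃ π : CuspidalAutomorphicRepData 1 K hcpt,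
      π.1.W = Submodule.span ℂ
          {fun g : (AdelicGroupData.gl 1 K).Adelic => (detTwist 1 (HeckeCharacter.normCharacter K ^ k) g : ℂ)} ∧
        π.1.W' = ⊥ ∧
        ∀ v : HeightOneSpectrum (𝓞 K),
          LocalGlobalCompatibleAt 𝓡 ι π.1
            (FramedRep.twist (1 : FramedGaloisRep K (PadicAlgCl ℓ) 1) (D2Cris.tateChar K ℓ k)) v := by
  obtain ⟨π, hW, hW', -, hc⟩ := automorphicToGalois_one_normPow 𝓡 hA ι k
  exact ⟨π, hW, hW', hc.2⟩

end NormPow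

end GLOneRigidity

end Summit.Langlands.Langlands.Theorems

end
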